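import Mathlib
import Summits.MatrixMultiplication.MatrixMultiplication.Theses.GroupTheoreticSTPP

/-!
# The finite core of the two-families conjecture (`GroupTheoreticSTPP.CPackingConstruction`)

Item `stmt-MatrixMultiplication-0595` (`CPackingConstruction`, CKSU 2005 Conj. 4.7 "two families",
verbatim; it is also the registered stub `stub_twoFamilies` of crux `ThinBlockAlpha.ThinPackings`,
stmt-MatrixMultiplication-10595, line `two-families-salem-spencer`).  Support file ("certificate on the
finite core"): what a finite computation can and cannot contribute to this `∀ δ > 0 ∀ n₀ ∃ n ≥ n₀ …`
statement.

* `pi_W`, `pi_X` — CKSU Lemma 21 (arXiv:math/0511460 p. 7, "Lemma 21"), power form: the two clauses (W)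
  (each pair direct) and (X) (simultaneity) of the simultaneous double product property pass to the
  family of word products `w ↦ (∏ₜ A (w t), ∏ₜ B (w t))`, `w : Fin L → Fin n`, in `Fin L → H`.
* `slice_of_design` — ONE finite design with `n ≥ 2` pairs, `|H| ≤ n^{2+δ}` and
  `n^{2-δ} ≤ |A i||B i|` gives the whole `δ`-slice (arbitrarily many pairs), by powers: pairs, host
  order and co-volumes are multiplicative, so the two exponent inequalities are scale-invariant.
* `cPackingConstruction_iff_finiteCore` — hence the conjecture is equivalent to: for every `δ > 0`
  there is ONE finite design at `δ` (the quantifier `∀ n₀` is eliminable).  Each slice is thus a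
  `Σ₁` statement, certifiable by exhibiting a single design and `decide`.
* `card_mul_card_lt_card` — but no finite design certifies ALL slices: in any family with clauses
  (W), (X), two indices `j ≠ k` and `A j`, `B k` non-empty, `|A j| |B j| < |H|` STRICTLY ((W) makes
  `(a, b) ↦ b - a` injective on `A j × B j`; (X) keeps the cross difference `y - x`, `x ∈ A j`,
  `y ∈ B k`, out of its image).  So `no_exact_design`: the exact core (`|H| ≤ n²` and
  `n² ≤ |A i||B i|`, `n ≥ 2`) is empty in EVERY finite abelian group, and `not_slice_zero`: the
  slice `δ = 0` of the conjecture is false — the content of the conjecture is the limit `δ → 0`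
  through an infinite family of designs, which no finite certificate reaches (by powers a design
  certifies the slices `δ ≥ max (log |H| / log n - 2, 2 - log (min |A i||B i|) / log n)`, a
  positive threshold; a finite alphabet of designs, mixed by products, only the slices above a
  positive threshold depending on the alphabet).

Smallest slice certified by designs in print (not formalised here): `δ ≈ 0.1813`, mixed powers of the
CKSU Prop. 4.5 designs in `(ℤ/4)^{2ℓ}` (`(α, β) → (log₂ 3, 2)`) and `(ℤ/5)^{2ℓ'}` (`(α, β) → (2, log₂ 5)`)
(arXiv:math/0511460 p. 8, "Proposition 24"; weights `t : 1 - t`, `t = log₂(5/4) / log₂(5/3)`, `δ = t · log₂(4/3)`).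
-/

-- single-conjunct summit: the mandated namespace repeats `MatrixMultiplication` (summit = sub-problem).
set_option linter.dupNamespace false

namespace Summit.MatrixMultiplication.MatrixMultiplication.Theorems.TwoFamiliesFiniteCore

open Finset
open Summit.MatrixMultiplication.MatrixMultiplication.Theses.GroupTheoreticSTPP (CPackingConstruction)

/-! ## CKSU Lemma 21, power form -/

section Power

variable {K : Type*} [AddCommGroup K] {r : ℕ} {X Y : Fin r → Finset K}

/-- **Powers keep clause (W)** (Cohn–Kleinberg–Szegedy–Umans 2005, Lemma 21, power form): if every
pair `(X c, Y c)` is direct, so is every word product `(∏ₜ X (w t), ∏ₜ Y (w t))` in `Fin L → K`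
(coordinatewise). -/
theorem pi_W
    (hW : ∀ c : Fin r, ∀ x ∈ X c, ∀ x' ∈ X c, ∀ y ∈ Y c, ∀ y' ∈ Y c,
      (x - x') + (y - y') = 0 → x = x' ∧ y = y')
    {L : ℕ} (w : Fin L → Fin r) :
    ∀ a ∈ Fintype.piFinset (fun t => X (w t)), ∀ a' ∈ Fintype.piFinset (fun t => X (w t)),
      ∀ b ∈ Fintype.piFinset (fun t => Y (w t)), ∀ b' ∈ Fintype.piFinset (fun t => Y (w t)),
        (a - a') + (b - b') = 0 → a = a' ∧ b = b' := by
  intro a ha a' ha' b hb b' hb' h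
  rw [Fintype.mem_piFinset] at ha ha' hb hb'
  have key : ∀ t, a t = a' t ∧ b t = b' t := fun t =>
    hW (w t) (a t) (ha t) (a' t) (ha' t) (b t) (hb t) (b' t) (hb' t)
      (by have := congrFun h t; simpa using this)
  exact ⟨funext fun t => (key t).1, funext fun t => (key t).2⟩

/-- **Powers keep clause (X)** (Cohn–Kleinberg–Szegedy–Umans 2005, Lemma 21, power form): if the
family `(X c, Y c)_{c<r}` is simultaneous, then for words `u v w : Fin L → Fin r` a relation
`(a - a') + (b - b') = 0` with `a ∈ ∏ X∘u`, `a' ∈ ∏ X∘v`, `b ∈ ∏ Y∘v`, `b' ∈ ∏ Y∘w` forces `u = w`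
(coordinate by coordinate). -/
theorem pi_X
    (hX : ∀ i j k : Fin r, ∀ a ∈ X i, ∀ a' ∈ X j, ∀ b ∈ Y j, ∀ b' ∈ Y k,
      (a - a') + (b - b') = 0 → i = k)
    {L : ℕ} (u v w : Fin L → Fin r) :
    ∀ a ∈ Fintype.piFinset (fun t => X (u t)), ∀ a' ∈ Fintype.piFinset (fun t => X (v t)),
      ∀ b ∈ Fintype.piFinset (fun t => Y (v t)), ∀ b' ∈ Fintype.piFinset (fun t => Y (w t)),
        (a - a') + (b - b') = 0 → u = w := by
  intro a ha a' ha' b hb b' hb' h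
  rw [Fintype.mem_piFinset] at ha ha' hb hb'
  funext t
  exact hX (u t) (v t) (w t) (a t) (ha t) (a' t) (ha' t) (b t) (hb t) (b' t) (hb' t)
    (by have := congrFun h t; simpa using this)

end Power

/-! ## One finite design gives its whole slice -/

/-- **One finite design gives its whole `δ`-slice** (the finite core of CKSU Conj. 4.7).  A family of
`n ≥ 2` pairs in a finite abelian group `H` with clauses (W), (X), `|H| ≤ n^{2+δ}` and
`n^{2-δ} ≤ |A i| |B i|` for all `i` yields, for every `n₀`, such a family with at least `n₀` pairs and
the SAME `δ`: take the `L`-th power (`L = n₀`, `n^L ≥ 2^L > n₀` pairs indexed by words, host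
`Fin L → H` of order `|H|^L ≤ (n^L)^{2+δ}`, co-volumes `∏ₜ |A (w t)||B (w t)| ≥ (n^L)^{2-δ}`).
[CKSU 2005 Lemma 21 + Prop. 4.6's closing remark "by taking direct powers … one can take `n`
arbitrarily large without changing `α` and `β`", arXiv:math/0511460 p. 8] -/
theorem slice_of_design {δ : ℝ} {n : ℕ} (hn : 2 ≤ n) {H : Type} [AddCommGroup H] [Fintype H]
    (A B : Fin n → Finset H)
    (hW : ∀ i : Fin n, ∀ a ∈ A i, ∀ a' ∈ A i, ∀ b ∈ B i, ∀ b' ∈ B i,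
      (a - a') + (b - b') = 0 → a = a' ∧ b = b')
    (hX : ∀ i j k : Fin n, ∀ a ∈ A i, ∀ a' ∈ A j, ∀ b ∈ B j, ∀ b' ∈ B k,
      (a - a') + (b - b') = 0 → i = k)
    (hH : (Fintype.card H : ℝ) ≤ (n : ℝ) ^ (2 + δ))
    (hV : ∀ i : Fin n, (n : ℝ) ^ (2 - δ) ≤ (((A i).card * (B i).card : ℕ) : ℝ)) (n₀ : ℕ) :
    ∃ N ≥ n₀, ∃ (G : Type) (_ : AddCommGroup G) (_ : Fintype G) (A' B' : Fin N → Finset G),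
      (∀ i : Fin N, ∀ a ∈ A' i, ∀ a' ∈ A' i, ∀ b ∈ B' i, ∀ b' ∈ B' i,
          (a - a') + (b - b') = 0 → a = a' ∧ b = b') ∧
      (∀ i j k : Fin N, ∀ a ∈ A' i, ∀ a' ∈ A' j, ∀ b ∈ B' j, ∀ b' ∈ B' k,
          (a - a') + (b - b') = 0 → i = k) ∧
      (Fintype.card G : ℝ) ≤ (N : ℝ) ^ (2 + δ) ∧
      ∀ i : Fin N, (N : ℝ) ^ (2 - δ) ≤ (((A' i).card * (B' i).card : ℕ) : ℝ) := by
  classical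
  have hNge : n₀ ≤ n ^ n₀ := (Nat.lt_two_pow_self).le.trans (Nat.pow_le_pow_left hn n₀)
  have hn0 : (0 : ℝ) ≤ n := Nat.cast_nonneg n
  let e : (Fin n₀ → Fin n) ≃ Fin (n ^ n₀) := finFunctionFinEquiv
  refine ⟨n ^ n₀, hNge, (Fin n₀ → H), inferInstance, inferInstance,
    fun idx => Fintype.piFinset fun t => A (e.symm idx t),
    fun idx => Fintype.piFinset fun t => B (e.symm idx t), ?_, ?_, ?_, ?_⟩
  · intro i
    exact pi_W hW (e.symm i)
  · intro i j k a ha a' ha' b hb b' hb' h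
    exact e.symm.injective (pi_X hX (e.symm i) (e.symm j) (e.symm k) a ha a' ha' b hb b' hb' h)
  · -- host order: `|H|^L ≤ (n^{2+δ})^L = (n^L)^{2+δ}`
    rw [Fintype.card_fun, Fintype.card_fin]
    push_cast
    calc (Fintype.card H : ℝ) ^ n₀ ≤ ((n : ℝ) ^ (2 + δ)) ^ n₀ :=
          pow_le_pow_left₀ (Nat.cast_nonneg _) hH n₀
      _ = ((n : ℝ) ^ n₀) ^ (2 + δ) := by
          rw [← Real.rpow_mul_natCast hn0, mul_comm, Real.rpow_natCast_mul hn0]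
  · -- co-volumes: `(n^L)^{2-δ} = ∏ₜ n^{2-δ} ≤ ∏ₜ |A (w t)||B (w t)|`
    intro idx
    dsimp only
    rw [Fintype.card_piFinset, Fintype.card_piFinset, ← Finset.prod_mul_distrib, Nat.cast_pow,
      Nat.cast_prod]
    calc ((n : ℝ) ^ n₀) ^ (2 - δ) = ((n : ℝ) ^ (2 - δ)) ^ n₀ := by
          rw [← Real.rpow_mul_natCast hn0, mul_comm, Real.rpow_natCast_mul hn0]
      _ = ∏ _t : Fin n₀, (n : ℝ) ^ (2 - δ) := by
          rw [Finset.prod_const, Finset.card_univ, Fintype.card_fin]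
      _ ≤ ∏ t, (((A (e.symm idx t)).card * (B (e.symm idx t)).card : ℕ) : ℝ) :=
          Finset.prod_le_prod (fun t _ => by positivity) (fun t _ => hV _)

/-- **The finite core of the two-families conjecture.**  `CPackingConstruction` (CKSU 2005
Conj. 4.7: `∀ δ > 0 ∀ n₀ ∃ n ≥ n₀ …`) holds iff for every `δ > 0` there is ONE finite design with
`n ≥ 2` pairs, clauses (W), (X), `|H| ≤ n^{2+δ}` and `n^{2-δ} ≤ |A i||B i|`: the quantifier `∀ n₀` is
eliminable by `slice_of_design`, so each slice is certified by a single finite witness. -/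
theorem cPackingConstruction_iff_finiteCore :
    CPackingConstruction ↔
      ∀ δ : ℝ, 0 < δ → ∃ n ≥ 2, ∃ (H : Type) (_ : AddCommGroup H) (_ : Fintype H)
        (A B : Fin n → Finset H),
        (∀ i : Fin n, ∀ a ∈ A i, ∀ a' ∈ A i, ∀ b ∈ B i, ∀ b' ∈ B i,
            (a - a') + (b - b') = 0 → a = a' ∧ b = b') ∧
        (∀ i j k : Fin n, ∀ a ∈ A i, ∀ a' ∈ A j, ∀ b ∈ B j, ∀ b' ∈ B k,
            (a - a') + (b - b') = 0 → i = k) ∧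
        (Fintype.card H : ℝ) ≤ (n : ℝ) ^ (2 + δ) ∧
        ∀ i : Fin n, (n : ℝ) ^ (2 - δ) ≤ (((A i).card * (B i).card : ℕ) : ℝ) := by
  unfold CPackingConstruction
  constructor
  · intro h δ hδ
    exact h δ hδ 2
  · intro h δ hδ n₀
    obtain ⟨n, hn, H, _, _, A, B, hW, hX, hH, hV⟩ := h δ hδ
    exact slice_of_design hn A B hW hX hH hV n₀

/-! ## No finite design certifies every slice: the strict co-volume gap -/

/-- **Strict co-volume gap.**  In a family with clause (W) at `j` and clause (X), if `j ≠ k`, `A j` and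
`B k` are non-empty, then `|A j| |B j| < |H|` strictly: by (W) the map `(a, b) ↦ b - a` is injective on
`A j × B j`, and by (X) (at indices `(j, j, k)`) no cross difference `y - x` with `x ∈ A j`, `y ∈ B k`
lies in its image.  (CKSU 2005 §4, the reformulation after Def. 4.1: the diagonal sets `A_i⁻¹B_i` are
disjoint from the off-diagonal `A_i⁻¹B_k`.) -/
theorem card_mul_card_lt_card {n : ℕ} {H : Type*} [AddCommGroup H] [Fintype H] [DecidableEq H]
    {A B : Fin n → Finset H}
    (hW : ∀ i : Fin n, ∀ a ∈ A i, ∀ a' ∈ A i, ∀ b ∈ B i, ∀ b' ∈ B i,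
      (a - a') + (b - b') = 0 → a = a' ∧ b = b')
    (hX : ∀ i j k : Fin n, ∀ a ∈ A i, ∀ a' ∈ A j, ∀ b ∈ B j, ∀ b' ∈ B k,
      (a - a') + (b - b') = 0 → i = k)
    {j k : Fin n} (hjk : j ≠ k) (hA : (A j).Nonempty) (hB : (B k).Nonempty) :
    (A j).card * (B j).card < Fintype.card H := by
  obtain ⟨x, hx⟩ := hA
  obtain ⟨y, hy⟩ := hB
  -- the diagonal difference set of the pair `j`
  set D : Finset H := ((A j) ×ˢ (B j)).image (fun p : H × H => p.2 - p.1) with hD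
  have hcard : D.card = (A j).card * (B j).card := by
    rw [hD, Finset.card_image_of_injOn, Finset.card_product]
    rintro ⟨a, b⟩ hab ⟨a', b'⟩ hab' h
    rw [Finset.mem_coe, Finset.mem_product] at hab hab'
    change b - a = b' - a' at h
    have h0 : (a' - a) + (b - b') = 0 := by
      have : (a' - a) + (b - b') = (b - a) - (b' - a') := by abel
      rw [this, h, sub_self]
    obtain ⟨h1, h2⟩ := hW j a' hab'.1 a hab.1 b hab.2 b' hab'.2 h0
    rw [h1, h2]
  -- the cross difference `y - x` is not a diagonal difference
  have hnot : y - x ∉ D := by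
    intro hmem
    rw [hD, Finset.mem_image] at hmem
    obtain ⟨⟨a, b⟩, hab, hEq⟩ := hmem
    rw [Finset.mem_product] at hab
    change b - a = y - x at hEq
    have h0 : (x - a) + (b - y) = 0 := by
      have : (x - a) + (b - y) = (b - a) - (y - x) := by abel
      rw [this, hEq, sub_self]
    exact hjk (hX j j k x hx a hab.1 b hab.2 y hy h0)
  have hss : D ⊂ Finset.univ :=
    (Finset.ssubset_univ_iff).2 fun hDu => hnot (hDu ▸ Finset.mem_univ _)
  calc (A j).card * (B j).card = D.card := hcard.symm
    _ < (Finset.univ : Finset H).card := Finset.card_lt_card hss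
    _ = Fintype.card H := Finset.card_univ

/-- **The exact core is empty.**  No finite abelian group carries `n ≥ 2` pairs with clauses (W), (X),
`|H| ≤ n²` and `n² ≤ |A i||B i|` for all `i` (so a single finite design never certifies all slices
`δ > 0` at once: its exponents satisfy `log (min |A i||B i|) < log |H|`). -/
theorem no_exact_design {n : ℕ} (hn : 2 ≤ n) {H : Type*} [AddCommGroup H] [Fintype H]
    (A B : Fin n → Finset H)
    (hW : ∀ i : Fin n, ∀ a ∈ A i, ∀ a' ∈ A i, ∀ b ∈ B i, ∀ b' ∈ B i,
      (a - a') + (b - b') = 0 → a = a' ∧ b = b')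
    (hX : ∀ i j k : Fin n, ∀ a ∈ A i, ∀ a' ∈ A j, ∀ b ∈ B j, ∀ b' ∈ B k,
      (a - a') + (b - b') = 0 → i = k)
    (hH : Fintype.card H ≤ n ^ 2) (hV : ∀ i : Fin n, n ^ 2 ≤ (A i).card * (B i).card) : False := by
  classical
  have hpos : ∀ i : Fin n, 0 < (A i).card * (B i).card := fun i =>
    lt_of_lt_of_le (by positivity) (hV i)
  set j : Fin n := ⟨0, by omega⟩
  set k : Fin n := ⟨1, by omega⟩
  have hjk : j ≠ k := by simp [j, k, Fin.ext_iff]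
  have hA : (A j).Nonempty := Finset.card_pos.1 (Nat.pos_of_mul_pos_right (hpos j))
  have hB : (B k).Nonempty := Finset.card_pos.1 (Nat.pos_of_mul_pos_left (hpos k))
  have hlt := card_mul_card_lt_card hW hX hjk hA hB
  have := hV j
  omega

/-- **The slice `δ = 0` of CKSU Conj. 4.7 is false** (all finite abelian hosts): there is no
arbitrarily-large family with clauses (W), (X), `|H| ≤ n^{2+0}` and `n^{2-0} ≤ |A i||B i|`.  The
conjecture's content is the limit `δ → 0` through an infinite family of designs. -/
theorem not_slice_zero :
    ¬ ∀ n₀ : ℕ, ∃ n ≥ n₀, ∃ (H : Type) (_ : AddCommGroup H) (_ : Fintype H)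
        (A B : Fin n → Finset H),
        (∀ i : Fin n, ∀ a ∈ A i, ∀ a' ∈ A i, ∀ b ∈ B i, ∀ b' ∈ B i,
            (a - a') + (b - b') = 0 → a = a' ∧ b = b') ∧
        (∀ i j k : Fin n, ∀ a ∈ A i, ∀ a' ∈ A j, ∀ b ∈ B j, ∀ b' ∈ B k,
            (a - a') + (b - b') = 0 → i = k) ∧
        (Fintype.card H : ℝ) ≤ (n : ℝ) ^ (2 + (0 : ℝ)) ∧
        ∀ i : Fin n, (n : ℝ) ^ (2 - (0 : ℝ)) ≤ (((A i).card * (B i).card : ℕ) : ℝ) := by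
  intro h
  obtain ⟨n, hn, H, _, _, A, B, hW, hX, hH, hV⟩ := h 2
  rw [add_zero] at hH
  simp only [sub_zero] at hV
  have h2 : (n : ℝ) ^ (2 : ℝ) = ((n ^ 2 : ℕ) : ℝ) := by
    rw [Real.rpow_two, Nat.cast_pow]
  rw [h2] at hH
  simp only [h2] at hV
  exact no_exact_design hn A B hW hX (by exact_mod_cast hH) (fun i => by exact_mod_cast hV i)

end Summit.MatrixMultiplication.MatrixMultiplication.Theorems.TwoFamiliesFiniteCore
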